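/-
Copyright (c) 2026 the pub-hodgecm-mathlib formalisation cell (harness21).  Prover seat hodgecm-mathlib-LH4-p16 (g0), req620 Track A «(D-RAM) FOUR-FRAME» squad
(STAGE-1b, row (2) of the piece `f_{T₊}`, the (β₂) road under heir LEAD F0P3a-plan (g21) T20-18∕T20-19 (R-36) «PURE-CELL LEDGER, RELATIVE SIGNS»; β₂ sub-dealer
LH4-p04 (g8) BETA2-BOARD v1.1 row (L-K0); MECH-K0 v2 2d5a3e86), 2026-09-04.
-/
import Summits.HodgeConjecture.HodgeConjecture.Theorems.F0P3cDyRamRayDominatedCellLetter   -- ★ p861810 (this seat): the main-term letters (`D₀⁻¹ + ρD₀⁻¹ = jE pw`, `v_trace_div_sub_main_le`)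
import HarnessLib

/-!
# Crux `H413`, line LH4 «(D-RAM) FOUR-FRAME» — STAGE-1b, row (2), the (β₂) road (R-36), row (L-K0): «THE BOUNDARY TERM OF THE RAY SCALAR» — the ray scalar
# `e₀ = Tr_ρ(μ∕D₀)` of a vertex splits as MAIN `jE(μ_a·pw)` (`pw = ⟨w₀, w₀⟩`, the `E`-part `μ_a` of the depth multiplier) plus BOUNDARY `jE(μ_b)·Tr_ρ(α∕D₀)` (the
# `α`-part `μ_b`), and the boundary term has EXACT size `|μ_b|·|α − ρα|∕|D₀|` on every vertex whose `D₀` satisfies `|Tr_ρ(D₀⁻¹)| < |D₀⁻¹|·|α − ρα|` — the near cell `K₀`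

Cell `hodgecm-mathlib` (D-0151), FLOOR 0, crux item H413 = `stmt-HodgeConjecture-24833`, route of record `HCCMUnconditional`; squad F0∕P3c∕LH4; lane
`--supports stmt-HodgeConjecture-24833 --as helper` (count-neutral; pays NO tier-0 row).  THEOREMS ONLY (no `def`, no instance, no notation, no `sorry`, default heartbeats);
★-only imports; states NO law; (β₂) stays a HYPOTHESIS.  DATUM-FREE `M`-letters: a valued field `M` with a ring endomorphism `ρ` (isometric), an element `α` (`|α| ≤ 1`), the
embedding `jE : E → M` fixed by `ρ`; no residue field, no `|2|`, no cell valuation letters.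

WHY (MECH-K0 v2 `F0/P3c/LH4/LH4-p16/g0/MECH-K0.v2.LH4p16g0.md` 2d5a3e86: the RamM per-Λ model reproduces LH4-cdis1 (g0) §1b (κ-b) to the vertex; LH4-p15 (g0) 16:19:20Z (1)∕(2)
S0–S3 «the boundary digit flips the label at q = 2»).  By ★ p861653 ∕ ★ p861810 the letter of a ray-dominated vertex is the thickened `a`-ray of ONE scalar
`e₀ = Tr_ρ(μ∕D₀)`, `D₀ = cc(α − ρα)·ΘY`, and ★ p861810 §1 reads `e₀ ≡ jE(f·h_W·t·N(ϖ^b g₁))` when the depth multiplier `μ = lam − jE u₀₀` is `E`-dominated at the scale `|jEϖ|^m·|D₀|`.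
ONE DIGIT SHORT of that scale (the (κ-b) row «`K₀ = −D` at `δ = 2d`», the U-type `S₁` at `δ = (2d−2) + m* − 1`) the label is decided by the BOUNDARY TERM: writing
`μ = jE μ_a + jE μ_b·α` (`α` the order generator of ★ DEFS `IsOrd`; `|μ_b| = |ϖ|^{jl}` the conductor digit, `|μ_a| = |ϖ|^m`),
`e₀ = jE(μ_a)·Tr_ρ(D₀⁻¹) + jE(μ_b)·Tr_ρ(α·D₀⁻¹) = jE(μ_a·pw) + jE(μ_b)·Tr_ρ(α·D₀⁻¹)` (§2 `trace_div_eq_main_add_boundary`), and the size of `Tr_ρ(α·k)`, `k = D₀⁻¹`, is governed by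
the identity `α·k + ρ(α·k) = α·(k + ρk) − ρk·(α − ρα)` (§1): `≤ max(|k + ρk|, |k|·|α − ρα|)` always, and `= |k|·|α − ρα|` EXACTLY as soon as `|k + ρk| < |k|·|α − ρα|` (`hk`).
THE MODEL FACT (MECH-K0 v2 §2): `hk` holds on EVERY vertex of the near cell `K₀` (RamM: `|D₀| = |ϖ|^{2a+2}`, `|pw| = |ϖ|^{−2a}`) and on NO vertex of the diagonal cell `D`
(`|D₀| = |ϖ|^{2a+1}`: equality), whence `|tail∕main| = |μ_b||α − ρα|∕(|μ_a||pw||D₀|) = |ϖ|^{δ−2}` on all of `K₀` — `= |ϖ|^{2(d−1)}` at `δ = 2d`, the digit at which `1 + ϖ_F^{d−1}·unit`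
is a non-norm (q = 2) and the label flips (LH4-p15's S1∕S3), `≥ |ϖ|^{m*}` for `δ ≥ 2d + 2` (★ p861810: `K₀ = +D`).
* §1 `gen_mul_add_map_eq` (the identity), `v_gen_mul_add_map_le` (the bound), `v_gen_mul_add_map_eq_of_lt` (EXACTNESS under `hk`).
* §2 `trace_div_eq_main_add_boundary` (the split of `e₀`), `v_boundary_eq_of_lt` (exact size of the boundary term under `hk`), `v_boundary_le` (the bound without `hk`),
  `v_trace_div_sub_main_eq_of_lt` (`|e₀ − jE(μ_a·pw)| = |μ_b|·|α − ρα|∕|D₀|` exactly) and the RATIO form `v_trace_div_div_main_sub_one_eq_of_lt`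
  (`e₀ = jE(μ_a pw)·(1 + η)`, `|η| = |μ_b|·|α − ρα|∕(|μ_a·pw|·|D₀|)` — the `|η_S|`-input of LH4-p15's two-cell relative form S3).
* §3 `gen_sq_mul_add_map_eq` (`α² = (α + ρα)α − αρα` under the trace), `v_boundary_le_of_eq_gen_mul` — the DIAGONAL side: when `D₀⁻¹ = jE(c)·α·w` the boundary term is
  bounded one digit below the crude `|D₀|⁻¹` (the `|η_D| ≤ |ϖ|^{m*}`-input of S3 at `δ = 2d`).
WHAT IS NOT CLAIMED: which cells satisfy `hk` ∕ the factorisation (the RamM∕U dictionaries: LH7-p10 ★ p861491, MECH-K0 v2 numerics), the flip itself (LH4-p15 ★ p861900).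
HONEST LABEL.  Count-neutral valuation algebra; nothing printed is asserted; no census law is stated; `HC_CM` is proved only modulo the 7 printed citations (2 remaining named
inputs: hLiu418 = `stmt-HodgeConjecture-24832`, h413 = `stmt-HodgeConjecture-24833`) until rung 0 closes.
## References
* [Serre1979] J.-P. Serre, *Local Fields*, GTM 67 (1979): Ch. III §6 Prop. 12 (orders of conductor `c`), Ch. V §3 Cor. 3 (norm classes of units; the last digit).
* [Jacobowitz1962] R. Jacobowitz, *Hermitian forms over local fields*, Amer. J. Math. 84 (1962): §4 (dual lattices, gluing: `⟨w₀, w₀⟩`).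
* [Rogawski1990] J. D. Rogawski, *Automorphic Representations of Unitary Groups in Three Variables*, Ann. of Math. Stud. 123 (1990): §4.9 Prop. 4.9.1 (b) p. 55.
* [Kottwitz1986BaseChangeUnits] R. E. Kottwitz, *Base change for unit elements of Hecke algebras*, Compositio Math. 60 (1986): §1 pp. 240–241.
-/

set_option autoImplicit false

noncomputable section

namespace Summit.HodgeConjecture.HodgeConjecture.Cruxes.H413.F0P3cDyRamRayScalarBoundaryTerm

open scoped Valued WithZero

variable {E M : Type} [Field E] [Valued E ℤᵐ⁰] [Field M] [Valued M ℤᵐ⁰] {ρ : M →+* M} {α : M}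

/-! ## §1 The boundary identity `α·k + ρ(α·k) = α·(k + ρk) − ρk·(α − ρα)` and its two valuation readings -/

omit [Valued E ℤᵐ⁰] [Valued M ℤᵐ⁰] [Field E] in
/-- **THE BOUNDARY IDENTITY**: `α·k + ρ(α·k) = α·(k + ρk) − ρk·(α − ρα)`. [cite: Serre1979, Ch. III §6 Prop. 12] -/
theorem gen_mul_add_map_eq (ρ : M →+* M) (α k : M) : α * k + ρ (α * k) = α * (k + ρ k) - ρ k * (α - ρ α) := by
  rw [map_mul]; ring

omit [Field E] [Valued E ℤᵐ⁰] in
/-- **THE BOUND**: for `ρ` isometric and `|α| ≤ 1`, `|α·k + ρ(α·k)| ≤ max(|k + ρk|, |k|·|α − ρα|)`. [cite: Serre1979, Ch. III §6 Prop. 12] -/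
theorem v_gen_mul_add_map_le (hvρ : ∀ x, Valued.v (ρ x) = Valued.v x) (hα1 : Valued.v α ≤ 1) (k : M) :
    Valued.v (α * k + ρ (α * k)) ≤ max (Valued.v (k + ρ k)) (Valued.v k * Valued.v (α - ρ α)) := by
  rw [gen_mul_add_map_eq ρ α k]
  refine (Valuation.map_sub _ _ _).trans (max_le_max ?_ (le_of_eq ?_))
  · rw [Valuation.map_mul]
    calc Valued.v α * Valued.v (k + ρ k) ≤ 1 * Valued.v (k + ρ k) := mul_le_mul' hα1 le_rfl
      _ = Valued.v (k + ρ k) := one_mul _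
  · rw [Valuation.map_mul, hvρ]

omit [Field E] [Valued E ℤᵐ⁰] in
/-- **EXACTNESS UNDER `hk`**: for `ρ` isometric, `|α| ≤ 1` and `|k + ρk| < |k|·|α − ρα|` (the `ρ`-trace of `k` loses MORE than `|α − ρα|`), the trace of `α·k` is EXACT:
`|α·k + ρ(α·k)| = |k|·|α − ρα|`. [cite: Serre1979, Ch. III §6 Prop. 12] [cite: Serre1979, Ch. V §3 Cor. 3] -/
theorem v_gen_mul_add_map_eq_of_lt (hvρ : ∀ x, Valued.v (ρ x) = Valued.v x) (hα1 : Valued.v α ≤ 1) {k : M}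
    (hk : Valued.v (k + ρ k) < Valued.v k * Valued.v (α - ρ α)) :
    Valued.v (α * k + ρ (α * k)) = Valued.v k * Valued.v (α - ρ α) := by
  rw [gen_mul_add_map_eq ρ α k, sub_eq_add_neg]
  have h2 : Valued.v (-(ρ k * (α - ρ α))) = Valued.v k * Valued.v (α - ρ α) := by
    rw [Valuation.map_neg, Valuation.map_mul, hvρ]
  have h1 : Valued.v (α * (k + ρ k)) < Valued.v (-(ρ k * (α - ρ α))) := by
    rw [h2, Valuation.map_mul]
    calc Valued.v α * Valued.v (k + ρ k) ≤ 1 * Valued.v (k + ρ k) := mul_le_mul' hα1 le_rfl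
      _ = Valued.v (k + ρ k) := one_mul _
      _ < Valued.v k * Valued.v (α - ρ α) := hk
  rw [Valuation.map_add_eq_of_lt_right _ h1, h2]

/-! ## §2 The ray scalar splits as MAIN + BOUNDARY; the boundary term is exact under `hk` -/

omit [Valued E ℤᵐ⁰] [Valued M ℤᵐ⁰] in
/-- **THE SPLIT OF THE RAY SCALAR**: for `μ = jE μ_a + jE μ_b·α` (`E`-part and `α`-part of the depth multiplier), `ρ` fixing `jE(E)`, and `D₀⁻¹ + ρD₀⁻¹ = jE pw`
(★ p861637 `inv_add_map_inv_eq_map_pairing`: `pw = ⟨w₀, w₀⟩`): `Tr_ρ(μ∕D₀) = jE(μ_a·pw) + jE(μ_b)·Tr_ρ(α·D₀⁻¹)`. [cite: Jacobowitz1962, §4] [cite: Kottwitz1986BaseChangeUnits, §1 pp. 240–241] -/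
theorem trace_div_eq_main_add_boundary (jE : E →+* M) (hρj : ∀ c, ρ (jE c) = jE c) (D₀ : M) {pw : E} (hTr : D₀⁻¹ + ρ D₀⁻¹ = jE pw) (μa μb : E) :
    (jE μa + jE μb * α) / D₀ + ρ ((jE μa + jE μb * α) / D₀) = jE (μa * pw) + jE μb * (α * D₀⁻¹ + ρ (α * D₀⁻¹)) := by
  rw [map_mul jE μa pw, ← hTr]
  simp only [div_eq_mul_inv, map_add, map_mul, hρj]
  ring

omit [Field E] [Valued E ℤᵐ⁰] in
/-- **THE BOUNDARY TERM IS EXACT UNDER `hk`**: `|C·Tr_ρ(α·D₀⁻¹)| = |C|·|D₀|⁻¹·|α − ρα|` whenever `|D₀⁻¹ + ρD₀⁻¹| < |D₀⁻¹|·|α − ρα|`.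
[cite: Serre1979, Ch. III §6 Prop. 12] [cite: Serre1979, Ch. V §3 Cor. 3] -/
theorem v_boundary_eq_of_lt (hvρ : ∀ x, Valued.v (ρ x) = Valued.v x) (hα1 : Valued.v α ≤ 1) (C D₀ : M)
    (hk : Valued.v (D₀⁻¹ + ρ D₀⁻¹) < Valued.v D₀⁻¹ * Valued.v (α - ρ α)) :
    Valued.v (C * (α * D₀⁻¹ + ρ (α * D₀⁻¹))) = Valued.v C * (Valued.v D₀)⁻¹ * Valued.v (α - ρ α) := by
  rw [Valuation.map_mul, v_gen_mul_add_map_eq_of_lt hvρ hα1 hk, map_inv₀, mul_assoc]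

omit [Field E] [Valued E ℤᵐ⁰] in
/-- **THE BOUNDARY TERM WITHOUT `hk`** (the diagonal cell): `|C·Tr_ρ(α·D₀⁻¹)| ≤ |C|·max(|D₀⁻¹ + ρD₀⁻¹|, |D₀|⁻¹·|α − ρα|)`. [cite: Serre1979, Ch. III §6 Prop. 12] -/
theorem v_boundary_le (hvρ : ∀ x, Valued.v (ρ x) = Valued.v x) (hα1 : Valued.v α ≤ 1) (C D₀ : M) :
    Valued.v (C * (α * D₀⁻¹ + ρ (α * D₀⁻¹))) ≤ Valued.v C * max (Valued.v (D₀⁻¹ + ρ D₀⁻¹)) ((Valued.v D₀)⁻¹ * Valued.v (α - ρ α)) := by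
  rw [Valuation.map_mul, ← map_inv₀]
  exact mul_le_mul' le_rfl (v_gen_mul_add_map_le hvρ hα1 D₀⁻¹)

omit [Valued E ℤᵐ⁰] in
/-- **`e₀ − main` IS EXACTLY THE BOUNDARY TERM**: with `μ = jE μ_a + jE μ_b·α`, `D₀⁻¹ + ρD₀⁻¹ = jE pw` and `hk`:
`|Tr_ρ(μ∕D₀) − jE(μ_a·pw)| = |jE μ_b|·|D₀|⁻¹·|α − ρα|`. [cite: Serre1979, Ch. V §3 Cor. 3] [cite: Jacobowitz1962, §4] [cite: Kottwitz1986BaseChangeUnits, §1 pp. 240–241] -/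
theorem v_trace_div_sub_main_eq_of_lt (jE : E →+* M) (hρj : ∀ c, ρ (jE c) = jE c) (hvρ : ∀ x, Valued.v (ρ x) = Valued.v x) (hα1 : Valued.v α ≤ 1)
    (D₀ : M) {pw : E} (hTr : D₀⁻¹ + ρ D₀⁻¹ = jE pw) (hk : Valued.v (D₀⁻¹ + ρ D₀⁻¹) < Valued.v D₀⁻¹ * Valued.v (α - ρ α)) (μa μb : E) :
    Valued.v ((jE μa + jE μb * α) / D₀ + ρ ((jE μa + jE μb * α) / D₀) - jE (μa * pw)) = Valued.v (jE μb) * (Valued.v D₀)⁻¹ * Valued.v (α - ρ α) := by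
  rw [trace_div_eq_main_add_boundary jE hρj D₀ hTr μa μb, add_sub_cancel_left, v_boundary_eq_of_lt hvρ hα1 (jE μb) D₀ hk]

omit [Valued E ℤᵐ⁰] in
/-- **THE RATIO FORM** (input `|η|` of the two-cell relative flip): with `μ = jE μ_a + jE μ_b·α`, `D₀⁻¹ + ρD₀⁻¹ = jE pw`, `μ_a·pw ≠ 0` and `hk`, the ray scalar is
`e₀ = jE(μ_a·pw)·(1 + η)` with `|η| = |(e₀ ∕ jE(μ_a·pw)) − 1| = |jE μ_b|·|D₀|⁻¹·|α − ρα| ∕ |jE(μ_a·pw)|` EXACTLY.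
[cite: Serre1979, Ch. V §3 Cor. 3] [cite: Jacobowitz1962, §4] [cite: Kottwitz1986BaseChangeUnits, §1 pp. 240–241] -/
theorem v_trace_div_div_main_sub_one_eq_of_lt (jE : E →+* M) (hρj : ∀ c, ρ (jE c) = jE c) (hvρ : ∀ x, Valued.v (ρ x) = Valued.v x) (hα1 : Valued.v α ≤ 1)
    (D₀ : M) {pw : E} (hTr : D₀⁻¹ + ρ D₀⁻¹ = jE pw) (hk : Valued.v (D₀⁻¹ + ρ D₀⁻¹) < Valued.v D₀⁻¹ * Valued.v (α - ρ α))
    {μa μb : E} (hmain : jE (μa * pw) ≠ 0) :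
    Valued.v (((jE μa + jE μb * α) / D₀ + ρ ((jE μa + jE μb * α) / D₀)) / jE (μa * pw) - 1) =
      Valued.v (jE μb) * (Valued.v D₀)⁻¹ * Valued.v (α - ρ α) / Valued.v (jE (μa * pw)) := by
  have e : ((jE μa + jE μb * α) / D₀ + ρ ((jE μa + jE μb * α) / D₀)) / jE (μa * pw) - 1 =
      ((jE μa + jE μb * α) / D₀ + ρ ((jE μa + jE μb * α) / D₀) - jE (μa * pw)) / jE (μa * pw) := by
    field_simp
  rw [e, map_div₀, v_trace_div_sub_main_eq_of_lt jE hρj hvρ hα1 D₀ hTr hk μa μb]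

/-! ## §3 The diagonal side: `D₀⁻¹ = jE(c)·α·w` — the boundary term through `α² = (α + ρα)·α − α·ρα` -/

omit [Valued E ℤᵐ⁰] [Valued M ℤᵐ⁰] [Field E] in
/-- **THE SQUARE IDENTITY**: `α·(α·w) + ρ(α·(α·w)) = (α + ρα)·(α·w + ρ(α·w)) − α·ρα·(w + ρw)` (Vieta for `α` over the `ρ`-fixed field).
[cite: Serre1979, Ch. III §6 Prop. 12] -/
theorem gen_sq_mul_add_map_eq (ρ : M →+* M) (α w : M) :
    α * (α * w) + ρ (α * (α * w)) = (α + ρ α) * (α * w + ρ (α * w)) - α * ρ α * (w + ρ w) := by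
  simp only [map_mul]; ring

omit [Valued E ℤᵐ⁰] in
/-- **THE BOUNDARY TERM ON THE DIAGONAL SIDE**: if `D₀⁻¹ = jE(c)·α·w` (the inverse carries ONE factor `α` — MECH-K0 v2: the diagonal cell `D`, `w` a unit of the `Θ`-fixed field
with `|w + ρw|` small), then `|C·Tr_ρ(α·D₀⁻¹)| ≤ |C|·|jE c|·max(|α + ρα|·max(|w + ρw|, |w|·|α − ρα|), |α·ρα|·|w + ρw|)` (§3 identity + §1 bound) — one digit BELOW the
crude `|C|·|D₀|⁻¹` when `|α + ρα| ≤ |α − ρα|` and `|w + ρw| ≤ |α − ρα|²` (RamM: `|√2|`, `|2|`), which is what makes `D` clean at `δ = 2d` while `K₀` flips.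
[cite: Serre1979, Ch. III §6 Prop. 12] [cite: Serre1979, Ch. V §3 Cor. 3] -/
theorem v_boundary_le_of_eq_gen_mul (jE : E →+* M) (hρj : ∀ c, ρ (jE c) = jE c) (hvρ : ∀ x, Valued.v (ρ x) = Valued.v x)
    (hα1 : Valued.v α ≤ 1) (C : M) {D₀ : M} {c : E} {w : M} (hfac : D₀⁻¹ = jE c * α * w) :
    Valued.v (C * (α * D₀⁻¹ + ρ (α * D₀⁻¹))) ≤ Valued.v C * (Valued.v (jE c) *
      max (Valued.v (α + ρ α) * max (Valued.v (w + ρ w)) (Valued.v w * Valued.v (α - ρ α))) (Valued.v (α * ρ α) * Valued.v (w + ρ w))) := by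
  have e : α * D₀⁻¹ + ρ (α * D₀⁻¹) = jE c * (α * (α * w) + ρ (α * (α * w))) := by
    rw [hfac]; simp only [map_mul, hρj]; ring
  rw [e, gen_sq_mul_add_map_eq ρ α w, Valuation.map_mul, Valuation.map_mul]
  refine mul_le_mul' le_rfl (mul_le_mul' le_rfl ?_)
  refine (Valuation.map_sub _ _ _).trans (max_le_max ?_ ?_)
  · rw [Valuation.map_mul]
    exact mul_le_mul' le_rfl (v_gen_mul_add_map_le hvρ hα1 w)
  · rw [Valuation.map_mul]

/-! ## §4 (appended, ED. 2) The dictionary: `hk` holds on every cell strictly ABOVE the diagonal (order level `j` > tube depth `b`)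

ED. 2 discharges the first item of ED. 1's «NOT CLAIMED» list for the cells ABOVE the diagonal: `v_mul_pow_le_one_of_int` ∕ `v_map_mul_pow_le_one` (`|jE pw|·|jEϖ|^{2b} ≤ 1` from
integrality of the glue generator) and HEAD `hk_of_lt` — `hk` holds on EVERY cell with order level `j >` tube depth `b` (the near cell `K₀` and its tower), at a place of ANY type
(`|α − ρα|` cancels).  Still not claimed: the diagonal-side factorisation `D₀⁻¹ = jE(c)·α·w` per cell (RamM dictionary), the flip itself (LH4-p15 ★ p861900 S1″∕S3″). -/

/-- **THE GLUE PAIRING IS AT MOST `|ϖ|^{−2b}`**: integrality of the glue generator (`|pw + σ(g₁)·h_W·g₁| ≤ 1`), the unit `ϖ^b·g₁` and `|h_W| ≤ 1`, `|ϖ| ≤ 1`, `σ` isometric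
give `|pw|·|ϖ|^{2b} ≤ 1`. [cite: Jacobowitz1962, §4] -/
theorem v_mul_pow_le_one_of_int (σ : E →+* E) (hvσ : ∀ a, Valued.v (σ a) = Valued.v a) {ϖ : E} (hϖ1 : Valued.v ϖ ≤ 1)
    {pw g₁ hW : E} {b : ℕ} (hint : Valued.v (pw + σ g₁ * hW * g₁) ≤ 1) (hu : Valued.v (ϖ ^ b * g₁) = 1) (hh : Valued.v hW ≤ 1) :
    Valued.v pw * Valued.v ϖ ^ (2 * b) ≤ 1 := by
  have e : pw * (ϖ ^ b) ^ 2 = (pw + σ g₁ * hW * g₁) * (ϖ ^ b) ^ 2 - hW * ((ϖ ^ b * g₁) * (ϖ ^ b * σ g₁)) := by ring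
  have hu' : Valued.v (ϖ ^ b * σ g₁) = 1 := by rw [Valuation.map_mul, hvσ, ← Valuation.map_mul]; exact hu
  have h1 : Valued.v (pw * (ϖ ^ b) ^ 2) ≤ 1 := by
    rw [e]
    refine (Valuation.map_sub _ _ _).trans (max_le ?_ ?_)
    · rw [Valuation.map_mul, Valuation.map_pow]
      calc Valued.v (pw + σ g₁ * hW * g₁) * Valued.v (ϖ ^ b) ^ 2 ≤ 1 * 1 :=
            mul_le_mul' hint (pow_le_one₀ zero_le (by rw [Valuation.map_pow]; exact pow_le_one₀ zero_le hϖ1))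
        _ = 1 := mul_one _
    · rw [Valuation.map_mul, Valuation.map_mul, hu, hu', mul_one, mul_one]; exact hh
  rwa [Valuation.map_mul, Valuation.map_pow, Valuation.map_pow, ← pow_mul, mul_comm b 2] at h1

/-- **TRANSPORT**: `|pw|·|ϖ|^{2b} ≤ 1 → |jE pw|·|jEϖ|^{2b} ≤ 1` (`|jE c| ≤ 1 ↔ |c| ≤ 1`). [cite: Jacobowitz1962, §4] -/
theorem v_map_mul_pow_le_one (jE : E →+* M) (hjv : ∀ c, Valued.v (jE c) ≤ 1 ↔ Valued.v c ≤ 1) {pw ϖ : E} {b : ℕ}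
    (h : Valued.v pw * Valued.v ϖ ^ (2 * b) ≤ 1) : Valued.v (jE pw) * Valued.v (jE ϖ) ^ (2 * b) ≤ 1 := by
  have h1 : Valued.v (jE (pw * ϖ ^ (2 * b))) ≤ 1 := (hjv _).2 (by rw [Valuation.map_mul, Valuation.map_pow]; exact h)
  rwa [map_mul, map_pow, Valuation.map_mul, Valuation.map_pow] at h1

omit [Valued E ℤᵐ⁰] in
/-- **`hk` ABOVE THE DIAGONAL.**  In ★ p861372 HEAD B's letters `D₀ = cc·(α − ρα)·ΘY` with `Θ` isometric, the LEVEL `|Y| = |jEϖ|^b`, the ORDER `|cc| = |jEϖ|^j`, `0 < |jEϖ| < 1`,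
`α ≠ ρα`, the glue letter `D₀⁻¹ + ρD₀⁻¹ = jE pw` with `|jE pw|·|jEϖ|^{2b} ≤ 1` (§4 above): IF `b < j` (the cell lies strictly above the diagonal — the near cell `K₀ = (b+1, b)`
and the whole near tower; at a place of ANY type, `|α − ρα|` cancels) THEN `hk`: `|D₀⁻¹ + ρD₀⁻¹| < |D₀⁻¹|·|α − ρα|` — so §2's EXACT boundary term applies.
(On the diagonal `j = b` the two sides are EQUAL in the RamM model, MECH-K0 v2 §2, and §3 takes over.) [cite: Serre1979, Ch. III §6 Prop. 12] [cite: Jacobowitz1962, §4] -/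
theorem hk_of_lt {Θ : M →+* M} (hvΘ : ∀ x, Valued.v (Θ x) = Valued.v x) (jE : E →+* M) {ϖ : E} (hπ0 : Valued.v (jE ϖ) ≠ 0) (hπ1 : Valued.v (jE ϖ) < 1)
    (hα0 : α - ρ α ≠ 0) {cc Y D₀ : M} (hD₀ : D₀ = cc * (α - ρ α) * Θ Y) {j b : ℕ} (hY : Valued.v Y = Valued.v (jE ϖ) ^ b)
    (hccv : Valued.v cc = Valued.v (jE ϖ) ^ j) (hbj : b < j) {pw : E} (hTr : D₀⁻¹ + ρ D₀⁻¹ = jE pw)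
    (hpw : Valued.v (jE pw) * Valued.v (jE ϖ) ^ (2 * b) ≤ 1) :
    Valued.v (D₀⁻¹ + ρ D₀⁻¹) < Valued.v D₀⁻¹ * Valued.v (α - ρ α) := by
  have hαv : Valued.v (α - ρ α) ≠ 0 := (Valuation.ne_zero_iff _).2 hα0
  have hD₀v : Valued.v D₀ = Valued.v (jE ϖ) ^ j * Valued.v (α - ρ α) * Valued.v (jE ϖ) ^ b := by
    rw [hD₀, Valuation.map_mul, Valuation.map_mul, hvΘ, hccv, hY]
  have hD₀v0 : Valued.v D₀ ≠ 0 := by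
    rw [hD₀v]; exact mul_ne_zero (mul_ne_zero (pow_ne_zero _ hπ0) hαv) (pow_ne_zero _ hπ0)
  have hPn : Valued.v (jE ϖ) ^ (j + b) ≠ 0 := pow_ne_zero _ hπ0
  -- the key digit count: `|jE pw|·|jEϖ|^{j+b} < 1` because `j + b = 2b + (j − b)` with `j − b ≥ 1`
  have hkey : Valued.v (jE pw) * Valued.v (jE ϖ) ^ (j + b) < 1 := by
    obtain ⟨k, rfl⟩ : ∃ k, j = b + 1 + k := ⟨j - (b + 1), by omega⟩
    rw [show b + 1 + k + b = 2 * b + (k + 1) by ring, pow_add, ← mul_assoc, mul_comm]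
    exact mul_lt_one_of_lt_of_le (pow_lt_one₀ zero_le hπ1 (by omega)) hpw
  -- `|D₀⁻¹|·|α − ρα| = |jEϖ|^{−(j+b)}`
  have hR : Valued.v D₀⁻¹ * Valued.v (α - ρ α) = (Valued.v (jE ϖ) ^ (j + b))⁻¹ := by
    refine eq_inv_of_mul_eq_one_left ?_
    rw [pow_add, show Valued.v D₀⁻¹ * Valued.v (α - ρ α) * (Valued.v (jE ϖ) ^ j * Valued.v (jE ϖ) ^ b) =
        Valued.v D₀⁻¹ * (Valued.v (jE ϖ) ^ j * Valued.v (α - ρ α) * Valued.v (jE ϖ) ^ b) by ac_rfl, ← hD₀v, map_inv₀, inv_mul_cancel₀ hD₀v0]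
  rw [hTr, hR]
  have hP : 0 < (Valued.v (jE ϖ) ^ (j + b))⁻¹ := zero_lt_iff.2 (inv_ne_zero hPn)
  have h := mul_lt_mul_of_pos_right hkey hP
  rwa [one_mul, mul_assoc, mul_inv_cancel₀ hPn, mul_one] at h

end Summit.HodgeConjecture.HodgeConjecture.Cruxes.H413.F0P3cDyRamRayScalarBoundaryTerm

end
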